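import Mathlib.Order.Filter.AtTopBot.Basic
import Mathlib.Topology.Order.Basic
import Literature.Analysis.FunctionSpaces.FlatTorus
import Literature.Analysis.FunctionSpaces.TorusCalculus
import Literature.Analysis.FunctionSpaces.TorusSobolevNorm
import Literature.Analysis.FunctionSpaces.HolderNorm
import Literature.Analysis.FunctionSpaces.TorusFluidGlue
import HarnessLib
import HarnessLib.Audit

-- provenance: harness21/H21/H21/Statements/Turb/AnomalousDissipation.lean @ 078da6f (interim HEAD d8f2665); M5 mechanical rewrite
-- verdict clean-up: `BrueDeLellisQuestion21` / `BrueDeLellisQuestion22` re-read against the source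
-- (arXiv:2207.06301 §2 = CMP 400 (2023) §2, Questions 2.1/2.2; §1) and registered as OPEN statements
-- (docstrings `OPEN CONJECTURE — … [status: open]`; names and statements unchanged, see the module
-- docstring "Registry") (literature-prover-defact-Analysis-FluidPDE-AnomalousDissipati-4d4d21dd-0, 2026-08-15)
/-!
# Anomalous dissipation for the forced Navier–Stokes equations on `T³`
(family: Turb; trunk: Sobolev; outline `H21/Outlines/Sobolev.md` §3, item
`TurbAnomalousDissipation`; statements **turb.S10**, **turb.S11**, **turb.S13**)

We state the anomalous-dissipation results of Bruè–De Lellis (2023) and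
Bruè–Colombo–Crippa–De Lellis–Sorella (2024) for *smooth* solutions of the forced incompressible
Navier–Stokes system on the flat torus `T³ = UnitAddTorus (Fin 3)` over the time interval `[0,1]`,
and the two open questions of Bruè–De Lellis (§2, Questions 2.1/2.2; Buckmaster–Vicol, EMS
Surveys 6 (2020), §8, Problem 10) asking for the same phenomenon with a viscosity-independent
(resp. also time-independent) force.

## Registry: `BrueDeLellisQuestion21`, `BrueDeLellisQuestion22` are OPEN statements (verdict clean-up 2026-08-15)

Both closed `Prop`s below were seated as named facts, and their tenured prove-seats returned the
verdict *open problem*. Re-read against the held source (E. Bruè, C. De Lellis, arXiv:2207.06301 =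
Comm. Math. Phys. 400 (2023) 1507–1533; §2 "Further comments" and §1 — chunks 5 and 3 of the held
text `paper:arxiv-2207.06301`), the printed questions are, verbatim:

* **Question 2.1** ("Question 1." in the held plain-text rendering). "Is it possible to make the sequence
  `f^{ν_m}` independent of the viscosity parameter `ν_m`? In the latter case we mean that `f^{ν_m}`
  would be equal to a single `f ∈ ⋂_{α<1} C^α`: for finite positive viscosity `ν_m > 0` we could
  then expect to have `C^α` solutions, a degree of regularity which is enough to consider the
  solutions 'classical', given the regularity theory for the incompressible Navier–Stokes in three
  dimensions."
* **Question 2.2** ("Question 2.", ibid.). "Is it possible to make the sequence of forces `f^{ν_m}`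
  independent of time?" — followed by: "The above questions are interesting even in higher space
  dimensions. In fact we suspect that a positive answer to Question 2.1 on `T³` would give a
  positive answer to Question 2.2 on `T⁴`."

Status (literature check 2026-08, re-verified 2026-08-15 on the pages cited):

* `BrueDeLellisQuestion21` is the *smooth strengthening* of Question 2.1 — one force
  `f ∈ C^∞([0,1] × T³)` for all viscosities, a fixed smooth datum, classical (`C^∞`) solutions —
  and is **open**. It is *stronger than printed*: the printed question only asks for a single
  `f ∈ ⋂_{α<1} C^α`, deliberately below the `C¹` borderline of classical well-posedness of Euler
  (source, §1: "Given that `C¹` is a borderline regularity for local well-posedness of Euler, the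
  above discussions suggest to investigate what happens if we assume the bounds" (1.2), i.e.
  `sup_m ‖f^{ν_m}‖_{C([0,1];C^α(T³))} < ∞` for all `α ∈ (0,1)`), with solutions of finite (Hölder)
  regularity. Bruè–De Lellis themselves point out (§1, discussion
  before (1.2), and the Gronwall lemma of their appendix, Lemma 7 in the arXiv numbering) that
  anomalous dissipation on `[0,1]` for data and forces with *uniform smooth bounds* can only occur
  after the first blow-up time of the classical forced Euler solution, so a positive answer in the
  smooth form "would settle, as a corollary, the blow-up problem of incompressible Euler" for smooth
  force and data on `T³`, which is "still widely open" (loc. cit.); the tree records exactly this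
  reduction as the barrier `Literature.Barriers.AnomalousDissipation.BrueDeLellis2023_noAnomaly_beforeEulerSingularityNarrow`
  (`… → ¬ BrueDeLellisQuestion21`; discharged, `BrueDeLellis2023_noAnomaly_beforeEulerSingularityNarrow_holds`
  in `ClassicalEulerLimitProofs`).
  No construction with a `ν`-independent force of *any* regularity is known: Bruè–De Lellis 2023,
  BCCDS 2024, Cheskidov (arXiv:2311.04182) and Johansson–Sorella 2024/2026 all use forces `f^ν`
  depending on `ν`; none of the works citing the source located up to 2026-08 answers Question 2.1.
* The printed (Hölder-force) Question 2.1 is **not** vendored as a separate `def` in this file: its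
  solution class ("`C^α` solutions … 'classical' [by] the regularity theory") lies below the `C^∞`
  class of `Torus.IsClassicalNSSolutionOn`, the only forced solution notion on `T³` for which the
  dissipation functional `Torus.cumulativeDissipation` (classical gradient) is literal; a faithful
  version needs forced mild/weak solutions (`Literature.Analysis.FluidPDE.Torus.IsWeakNSSolutionForcedOn`,
  `WeakSolution.lean`) together with the spectral `Torus.eGradNormSq`, and is left to a definition
  item (this clean-up seat adds no new unproved closed statement, D-0026).
* `BrueDeLellisQuestion22` is the *combined* strengthening "Question 2.1 ∧ Question 2.2" — ONE smooth
  stationary force `f ∈ C^∞(T³)` for all viscosities and one smooth datum —, the finite-time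
  analogue of the registered summit statement `Literature.Turb.ZerothLaw`; it implies
  `BrueDeLellisQuestion21` (`BrueDeLellisQuestion22.question21`) and is **open** for the same reason.
  Question 2.2 *as printed* ("make the sequence of forces `f^{ν_m}` independent of time") is read in
  the literature as allowing `ν`-dependent, time-independent forces, and in that reading it has a
  **positive answer**: on `T⁴`, Johansson–Sorella, J. Differential Equations 453 (2026) 113912
  (arXiv:2303.09486), Thm. A ("Theorem 1" of the earlier arXiv version: time-independent forces
  `F_ν ∈ C^α(T⁴)` and smooth data `v_{in,ν}`, both depending on `ν`); on `T³`, Johansson–Sorella,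
  arXiv:2409.03599 (2024), Thm. 1.5 (p. 5: "a sequence of time independent smooth forces
  `{F_{ν_q}} ⊂ C^∞(T³)` and a sequence of smooth initial data `{v_{in,q}} ⊂ C^∞(T³)`", converging in
  `C^α`, with `limsup_{ν_q→0} ν_q ∫₀¹∫ |∇v_{ν_q}|² > 0` — pass to a subsequence for the `liminf`/`ε`-form;
  "this result answers two open questions by Bruè and De Lellis posed in [BDL23, Question 2.2 and
  Question 2.3]"). `BrueDeLellisQuestion22` is not the statement answered by Johansson–Sorella.
* Accordingly both are *registered open statements* (CONVENTIONS §4: an open conjecture is a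
  `def … : Prop`, never asserted): their docstrings begin `OPEN CONJECTURE —`, cite where the question
  is posed, and carry `[status: open]`; no `…_holds` theorem is to be expected, and users take them
  as explicit hypotheses `(h : BrueDeLellisQuestion21)` or refute them under stated assumptions. The
  statements are byte-for-byte unchanged and the NAMES ARE KEPT (no `…Conjecture` rename): both are
  used by their qualified names in `Literature/Barriers/AnomalousDissipation/ClassicalEulerLimit.lean`
  (the narrowed barrier destructures the witness tuple of `BrueDeLellisQuestion21`;
  `.not_question22`), as hypotheses `(hQ : …)` in `ClassicalEulerLimitProofs.lean`, and in the
  docstrings of `OnsagerSingularityLeray.lean`, `AnomalousDissipationWithoutDissipationAnomaly.lean`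
  and the route file `Summits/AnomalousDissipation/AnomalousDissipation/Theses/CoherentStates.lean`.

## Design choices

* Solutions are `Torus.IsClassicalNSSolutionOn (Icc 0 1) ν f u p` (accepted
  `Literature.Analysis.FunctionSpaces.TorusFluidGlue`; one-sided time derivative at `t = 0, 1`),
  the initial datum is the separate conjunct `u m 0 = u₀`, and the dissipated energy on `[0,1]` is
  `Torus.cumulativeDissipation ν u 0 1 = ν ∫₀¹ ‖∇u(t)‖₂² dt`.
* **ε-form of anomalous dissipation (mandated by the outline).** The papers write
  `liminf_m ν_m ∫₀¹ ‖∇u^{ν_m}‖² > 0`; since Mathlib's `Filter.liminf` of an unbounded real sequence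
  is a junk value, we use the equivalent `∃ ε > 0, ∀ᶠ m in atTop, ε ≤ ν_m ∫₀¹ ‖∇u^{ν_m}‖²`
  (`HasAnomalousDissipation`).
* The vanishing-viscosity family is indexed by `m : ℕ` with `ν : ℕ → ℝ` strictly decreasing to `0`
  and positive.
* Hölder bounds use the accepted `eBoundedHolderNorm` (`‖·‖_{C^{0,α}} = ‖·‖_∞ + [·]_α`),
  `ContinuousInHolderOn` (`C⁰_t C^α_x`) and `eLpHolderNorm` (`L^p_t C^α_x`) of
  `Literature.Analysis.FunctionSpaces.HolderNorm`, for the product (sup) metric of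
  `UnitAddTorus (Fin 3) = Fin 3 → AddCircle 1` (equivalent to the flat metric).
* In **turb.S13** the abstract of BCCDS reads "uniform bounds in `L³_t C^{1/3−ε}_x` for any fixed
  `ε > 0`"; we therefore quantify `∀ α < 1/3` *outside* the existential (the family may depend on
  `α`), which is what Thm 1.1 asserts. The accompanying uniform bound on the forces is recorded
  in the (certainly implied) form `L¹_t L^∞_x`, i.e. `eLpHolderNorm 1 0` (`eBoundedHolderNorm 0`
  is the sup norm plus the oscillation, hence between `‖·‖_∞` and `3‖·‖_∞`); the paper's own
  force bound is stronger (see the docstring). **Caveat.** In this `L¹_t C⁰_x` form the statement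
  is degenerate — it is discharged in `Literature.Analysis.FluidPDE.AnomalousDissipationProofs`
  (`bccds_onsager_critical_holds`) by a pulsed *Stokes* shear flow, exactly the phenomenon BCCDS
  exclude by their force class (arXiv:2212.08413, §1, Remark 2); a faithful vendoring must keep the
  force bound `sup_ν ‖F_ν‖_{L^{1+σ}([0,1]; C^σ(T³))} < ∞` for some `σ > 0` (their (1.4)).

## Mathlib

Mathlib has `UnitAddTorus`, `Filter.atTop`, `Filter.Eventually`, `Filter.Tendsto`, `StrictAnti`,
`eHolderNorm`/`MemHolder`; it has no Navier–Stokes notions, no anomalous dissipation and no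
space–time Hölder classes (searched: `NavierStokes`, `dissipation`, `Onsager` — none). Everything
fluid-mechanical comes from the accepted H21 prelude (`Literature.Analysis.FunctionSpaces.*`).

## References

* E. Bruè, C. De Lellis, *Anomalous dissipation for the forced 3D Navier–Stokes equations*,
  Comm. Math. Phys. 400 (2023) 1507–1533 (arXiv:2207.06301), Thm. 1.1, §2 Questions 2.1, 2.2
  (the first two questions of §2 "Further comments"), §1 and Appendix (Lemma 7, arXiv numbering).
  [`BrueDeLellisCMP2023`; the journal offprint is requested as acq-01765, the arXiv text is held]
* E. Bruè, M. Colombo, G. Crippa, C. De Lellis, M. Sorella, *Onsager critical solutions of the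
  forced Navier–Stokes equations*, Comm. Pure Appl. Anal. 23 (2024), Thm. 1.1; §1, Remark 2.
* T. Buckmaster, V. Vicol, *Convex integration and phenomenologies in turbulence*, EMS Surv.
  Math. Sci. 6 (2020) 173–263 (arXiv:1901.09023, 2019), §8 "Open problems", Problem 10
  (long-time averages, Leray–Hopf solutions, smooth forcing at `ν`-independent scales).
  [`BuckmasterVicol2020`]
* C. J. P. Johansson, M. Sorella, *Nontrivial absolutely continuous part of anomalous dissipation
  measures in time*, J. Differential Equations 453 (2026), 113912 (arXiv:2303.09486), Thm. A
  (label of the journal and of the current arXiv version, p. 3; the same main theorem is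
  labelled "Theorem 1", p. 4, in the earlier arXiv version) (Question 2.2 on `T⁴`, `ν`-dependent
  time-independent forces). [`JohanssonSorella2026`]
* C. J. P. Johansson, M. Sorella, *Anomalous dissipation via spontaneous stochasticity with a
  two-dimensional autonomous velocity field*, arXiv:2409.03599 (2024; journal version Duke Math. J.,
  doi:10.1215/00127094-2025-0067), Thm. 1.5 of the arXiv version (Question 2.2 on `T³`, `ν`-dependent
  time-independent smooth forces and `ν`-dependent smooth data). [`JohanssonSorella2024`]
* Later works citing the source checked for Question 2.1 (2026-08-15; 50 citing works in the
  OpenAlex graph): e.g. arXiv:2605.18126 (stability of the Bruè–De Lellis construction; forces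
  `f̃^{μ_m}` depend on the viscosity `μ_m`), Cheskidov–Peng arXiv:2512.24568 (Onsager-critical;
  `f^{ν_n} → f` in `L¹_t L^r_x`, `r < 2`), arXiv:2307.06812 (unforced, `ν`-dependent rough data) —
  none uses a viscosity-independent force.
* A. Cheskidov, *Dissipation anomaly and anomalous dissipation in incompressible fluid flows*,
  arXiv:2311.04182 (2023). [`Cheskidov2023`]
-/

open MeasureTheory Set Filter Topology
open scoped NNReal ENNReal

noncomputable section

namespace Literature.Analysis.FluidPDE

section Turb

/-- The flat unit `3`-torus `T³ = ℝ³/ℤ³` (Mathlib's `UnitAddTorus (Fin 3)`), the spatial domain of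
Bruè–De Lellis 2023 and BCCDS 2024. [cite: BrueDeLellisCMP2023, §1 system (NS)] -/
abbrev T3 : Type := UnitAddTorus (Fin 3)

/-- Euclidean `ℝ³` (Mathlib's `EuclideanSpace ℝ (Fin 3)`), the range of velocity fields and
forces on `T³`. [folklore] -/
abbrev R3 : Type := EuclideanSpace ℝ (Fin 3)

/-- **Anomalous dissipation** of a vanishing-viscosity family `(u m)_m` of velocity fields on
`T³ × [0,1]` with viscosities `ν m`: the energy dissipated on `[0,1]`,
`ν_m ∫₀¹ ‖∇u^{ν_m}(t)‖²_{L²} dt = Torus.cumulativeDissipation (ν m) (u m) 0 1`, stays bounded away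
from `0` along the sequence, i.e. `liminf_m ν_m ∫₀¹ ‖∇u^{ν_m}‖² > 0`
(Bruè–De Lellis, CMP 400 (2023), (1.3) in Thm. 1.1; Buckmaster–Vicol, EMS Surv. 6 (2020), §8).
Stated in the equivalent `ε`-form `∃ ε > 0, ∀ᶠ m, ε ≤ ν_m ∫₀¹ ‖∇u^{ν_m}‖²` to avoid the junk value
of `Filter.liminf` on unbounded real sequences. [folklore] -/
def HasAnomalousDissipation (ν : ℕ → ℝ) (u : ℕ → ℝ → T3 → R3) : Prop :=
  ∃ ε : ℝ, 0 < ε ∧ ∀ᶠ m in atTop, ε ≤ FunctionSpaces.Torus.cumulativeDissipation (ν m) (u m) 0 1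

/-- A family with anomalous dissipation has, eventually, strictly positive dissipation on
`[0,1]`. [folklore] -/
theorem HasAnomalousDissipation.eventually_pos {ν : ℕ → ℝ} {u : ℕ → ℝ → T3 → R3}
    (h : HasAnomalousDissipation ν u) :
    ∀ᶠ m in atTop, 0 < FunctionSpaces.Torus.cumulativeDissipation (ν m) (u m) 0 1 := by
  obtain ⟨ε, hε, hev⟩ := h
  exact hev.mono fun m hm => hε.trans_le hm

/-- If the dissipation tends to `0` along the family, there is no anomalous dissipation (the
`ε`-form is the negation of `liminf = 0` for nonnegative sequences). [folklore] -/
theorem not_hasAnomalousDissipation_of_tendsto_zero {ν : ℕ → ℝ} {u : ℕ → ℝ → T3 → R3}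
    (h : Tendsto (fun m => FunctionSpaces.Torus.cumulativeDissipation (ν m) (u m) 0 1) atTop (𝓝 0)) :
    ¬ HasAnomalousDissipation ν u := by
  rintro ⟨ε, hε, hev⟩
  have hlt : ∀ᶠ m in atTop, FunctionSpaces.Torus.cumulativeDissipation (ν m) (u m) 0 1 < ε :=
    h.eventually (Iio_mem_nhds hε)
  obtain ⟨m, hm₁, hm₂⟩ := (hev.and hlt).exists
  exact (lt_irrefl ε) (hm₁.trans_lt hm₂)

/-- A **vanishing-viscosity sequence**: `ν : ℕ → ℝ` strictly decreasing, positive, with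
`ν m → 0` (the "`ν_q → 0`" of Bruè–De Lellis 2023, Thm. 1.1). [cite: BrueDeLellisCMP2023, Thm. 1.1] -/
def IsVanishingViscosity (ν : ℕ → ℝ) : Prop :=
  StrictAnti ν ∧ Tendsto ν atTop (𝓝 0) ∧ ∀ m, 0 < ν m

/-- **turb.S10** (Bruè–De Lellis, *Anomalous dissipation for the forced 3D Navier–Stokes
equations*, CMP 400 (2023), Thm. 1.1). There exist viscosities `ν_m ↓ 0`, a smooth initial datum
`u₀` on `T³` (independent of `m`), smooth body forces `f_m ∈ C^∞([0,1] × T³)` which are uniformly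
bounded in `C⁰([0,1]; C^α(T³))` for every `α < 1`, i.e. `sup_m sup_{t ∈ [0,1]} ‖f_m(t)‖_{C^α} < ∞`
with each `t ↦ f_m(t)` continuous into `C^α`, and smooth solutions `(u_m, p_m)` on `[0,1]` of the
forced Navier–Stokes system `∂ₜu + (u·∇)u + ∇p = ν_m Δu + f_m`, `div u = 0`, `u(0) = u₀`, whose
energy dissipation is anomalous: `liminf_m ν_m ∫₀¹ ‖∇u_m(t)‖²_{L²(T³)} dt > 0`.
Relation to the printed theorem (arXiv:2207.06301, Thm. 1.1 with (1.2)–(1.3)): the paper has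
`ν_m ↓ 0` (here `StrictAnti`, equivalent after passing to a subsequence, along which `liminf` can
only increase) and additionally asserts *uniqueness* of the smooth solution, which this `Prop`
does not record (weaker); the `C([0,1]; C^α)` bound (1.2) is the conjunction of the uniform
`C^{0,α}` bound and the continuity clause below. [cite: BrueDeLellisCMP2023, Thm. 1.1] -/
def brue_deLellis_anomalous_dissipation : Prop :=
  ∃ (ν : ℕ → ℝ) (u₀ : T3 → R3) (f u : ℕ → ℝ → T3 → R3) (p : ℕ → ℝ → T3 → ℝ),
      IsVanishingViscosity ν ∧ FunctionSpaces.Torus.IsSmooth u₀ ∧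
      (∀ m, FunctionSpaces.Torus.IsSmoothSpaceTimeOn (Icc 0 1) (f m)) ∧
      (∀ m, FunctionSpaces.Torus.IsClassicalNSSolutionOn (Icc 0 1) (ν m) (f m) (u m) (p m) ∧ u m 0 = u₀) ∧
      (∀ α : ℝ≥0, α < 1 →
        (∃ C : ℝ≥0∞, C < ∞ ∧ ∀ m, ∀ t ∈ Icc (0 : ℝ) 1, FunctionSpaces.eBoundedHolderNorm α (f m t) ≤ C) ∧
        ∀ m, FunctionSpaces.ContinuousInHolderOn (Icc 0 1) α (f m)) ∧
      HasAnomalousDissipation ν u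

/-- OPEN CONJECTURE — **turb.S11**, the smooth (`C^∞`) strengthening of Bruè–De Lellis'
**Question 2.1**, posed in E. Bruè, C. De Lellis, *Anomalous dissipation for the forced 3D
Navier–Stokes equations*, Comm. Math. Phys. 400 (2023) 1507–1533, §2 "Further comments",
Question 2.1 (= arXiv:2207.06301, §2, first question; cf. Buckmaster–Vicol, EMS Surv. Math. Sci. 6
(2020), §8, Problem 10, its long-time-average form) [status: open].
The `Prop` asserting a positive answer, in smooth form, to Question 2.1: there are a *single*
smooth body force `f ∈ C^∞([0,1] × T³)`, independent of the viscosity, a smooth initial datum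
`u₀`, viscosities `ν_m ↓ 0` and smooth solutions `(u_m, p_m)` on `[0,1]` of the Navier–Stokes
system with viscosity `ν_m`, force `f` and datum `u₀`, such that
`liminf_m ν_m ∫₀¹ ‖∇u_m‖²_{L²} > 0`.
**Relation to the source (stronger than printed).** The printed question reads "Is it possible to
make the sequence `f^{ν_m}` independent of the viscosity parameter `ν_m`? In the latter case we mean
that `f^{ν_m}` would be equal to a single `f ∈ ⋂_{α<1} C^α`: for finite positive viscosity
`ν_m > 0` we could then expect to have `C^α` solutions, a degree of regularity which is enough to
consider the solutions 'classical' …" — a single force of Hölder class below `C¹` and solutions of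
finite regularity; this `Prop` demands `f ∈ C^∞` and `C^∞` solutions (a strengthening; the printed
Hölder-force question is not vendored in this file, see the module docstring). By the source's own
remark (§1: uniform smooth bounds on data and forces rule out anomalous dissipation before the
first blow-up time of the classical forced Euler solution; Gronwall lemma of the appendix), a proof
of this `Prop` would in particular exhibit finite-time loss of regularity for forced 3D Euler on
`T³` with smooth force and smooth data, a problem the source calls "still widely open"; the tree
proves the reduction as
`Literature.Barriers.AnomalousDissipation.BrueDeLellis2023_noAnomaly_beforeEulerSingularityNarrow`
(classical solvability of smooth-forced Euler on `[0,1] × T³` `→ ¬ BrueDeLellisQuestion21`;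
discharged in `ClassicalEulerLimitProofs`).
Status 2026-08 (re-verified 2026-08-15): open; no anomalous-dissipation construction with a
`ν`-independent force is known (module docstring, "Registry"). Registered open statement, not a
dischargeable literature fact: no `BrueDeLellisQuestion21_holds` is to be expected; use it as a
hypothesis `(h : BrueDeLellisQuestion21)` or refute it under stated assumptions.
[cite: BrueDeLellisCMP2023, §2 Question 2.1] -/
@[conjecture] def BrueDeLellisQuestion21 : Prop :=
  ∃ (ν : ℕ → ℝ) (u₀ : T3 → R3) (f : ℝ → T3 → R3) (u : ℕ → ℝ → T3 → R3) (p : ℕ → ℝ → T3 → ℝ),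
    IsVanishingViscosity ν ∧ FunctionSpaces.Torus.IsSmooth u₀ ∧ FunctionSpaces.Torus.IsSmoothSpaceTimeOn (Icc 0 1) f ∧
    (∀ m, FunctionSpaces.Torus.IsClassicalNSSolutionOn (Icc 0 1) (ν m) f (u m) (p m) ∧ u m 0 = u₀) ∧
    HasAnomalousDissipation ν u

/-- OPEN CONJECTURE — **turb.S11**, Bruè–De Lellis' **Questions 2.1 and 2.2 combined** (one
viscosity-independent AND time-independent smooth force), posed in E. Bruè, C. De Lellis,
Comm. Math. Phys. 400 (2023) 1507–1533, §2 "Further comments", Questions 2.1–2.2 (= arXiv:2207.06301,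
§2, first two questions; cf. Buckmaster–Vicol, EMS Surv. Math. Sci. 6 (2020), §8, Problem 10, and
the registered summit statement `Literature.Turb.ZerothLaw`, its long-time-average form)
[status: open].
The same as `BrueDeLellisQuestion21` with a *time-independent* smooth force `f ∈ C^∞(T³)`: there
are `ν_m ↓ 0`, a smooth datum `u₀` and smooth solutions `(u_m, p_m)` on `[0,1]` of Navier–Stokes
with viscosity `ν_m` and the stationary, `ν`-independent force `f`, with
`liminf_m ν_m ∫₀¹ ‖∇u_m‖²_{L²} > 0`. Stated as the `Prop` asserting a positive answer.
**Relation to the source.** Question 2.2 as printed — "Is it possible to make the sequence of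
forces `f^{ν_m}` independent of time?" (the source adds: "we suspect that a positive answer to
Question 2.1 on `T³` would give a positive answer to Question 2.2 on `T⁴`") — is read in the
literature as allowing forces that are time-independent but still depend on `ν`, and in that
reading it has been answered positively: Johansson–Sorella, J. Differential Equations 453 (2026)
113912, Thm. A ("Theorem 1" of the earlier arXiv version 2303.09486; on `T⁴`, forces
`F_ν ∈ C^α(T⁴)` and smooth data depending on `ν`) and Johansson–Sorella, arXiv:2409.03599, Thm. 1.5 (on `T³`;
time-independent smooth forces `F_{ν_q}` and smooth data `v_{in,q}` depending on `q`, converging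
in `C^α`; `limsup` form, pass to a subsequence; "this result answers … [BDL23, Question 2.2 and
Question 2.3]"). The present `Prop` additionally fixes ONE force for all viscosities (Question 2.1)
and one smooth datum, so it is strictly stronger than what these results provide and implies
`BrueDeLellisQuestion21` (`BrueDeLellisQuestion22.question21`); as for `…21`, a proof would exhibit
finite-time loss of regularity for smooth forced 3D Euler on `T³` (source, §1; in the tree:
`Literature.Barriers.AnomalousDissipation.BrueDeLellis2023_noAnomaly_beforeEulerSingularityNarrow.not_question22`).
Status 2026-08 (re-verified 2026-08-15): open. Registered open statement, not a dischargeable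
literature fact: no `BrueDeLellisQuestion22_holds` is to be expected.
[cite: BrueDeLellisCMP2023, §2 Questions 2.1–2.2] -/
@[conjecture] def BrueDeLellisQuestion22 : Prop :=
  ∃ (ν : ℕ → ℝ) (u₀ f : T3 → R3) (u : ℕ → ℝ → T3 → R3) (p : ℕ → ℝ → T3 → ℝ),
    IsVanishingViscosity ν ∧ FunctionSpaces.Torus.IsSmooth u₀ ∧ FunctionSpaces.Torus.IsSmooth f ∧
    (∀ m, FunctionSpaces.Torus.IsClassicalNSSolutionOn (Icc 0 1) (ν m) (fun _ => f) (u m) (p m) ∧ u m 0 = u₀) ∧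
    HasAnomalousDissipation ν u

/-- A positive answer to `BrueDeLellisQuestion22` (one stationary, `ν`-independent smooth force)
gives one to `BrueDeLellisQuestion21` (one `ν`-independent smooth space–time force): a constant-in-time
smooth field is jointly smooth on `[0,1] × T³`. [folklore] -/
theorem BrueDeLellisQuestion22.question21 (h : BrueDeLellisQuestion22) :
    BrueDeLellisQuestion21 := by
  obtain ⟨ν, u₀, f, u, p, hν, hu₀, hf, hsol, hdiss⟩ := h
  refine ⟨ν, u₀, fun _ => f, u, p, hν, hu₀, ?_, hsol, hdiss⟩
  have hst : FunctionSpaces.Torus.stLift (fun _ : ℝ => f) = FunctionSpaces.Torus.lift f ∘ Prod.snd := by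
    funext q
    obtain ⟨t, y⟩ := q
    simp [FunctionSpaces.Torus.stLift_apply, FunctionSpaces.Torus.lift]
  unfold FunctionSpaces.Torus.IsSmoothSpaceTimeOn
  rw [hst]
  exact (hf.comp contDiff_snd).contDiffOn

/-- **turb.S13** (Bruè–Colombo–Crippa–De Lellis–Sorella, *Onsager critical solutions of the
forced Navier–Stokes equations*, Comm. Pure Appl. Anal. 23 (2024), Thm. 1.1). Onsager-critical
anomalous dissipation: for every `α < 1/3` there exist viscosities `ν_m ↓ 0`, a smooth initial
datum `u₀`, smooth body forces `f_m` on `[0,1] × T³`, uniformly bounded in `m` (recorded here in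
`L¹([0,1]; L^∞(T³))`; the paper's bound on the forces is in a stronger mixed Lebesgue–Hölder
norm), and smooth solutions `(u_m, p_m)` on `[0,1]` of forced Navier–Stokes with viscosity `ν_m`
and `u_m(0) = u₀`, which dissipate anomalously, `liminf_m ν_m ∫₀¹ ‖∇u_m‖²_{L²} > 0`, and are
uniformly bounded in the Onsager-critical class `L³([0,1]; C^α(T³))`:
`sup_m ‖u_m‖_{L³_t C^{0,α}_x} < ∞` ("`C^{1/3−}`"). This answers Bruè–De Lellis 2023,
Question 2.4. Relation to the printed theorem (arXiv:2212.08413, Thm. 1.1): the paper has a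
continuum family `{F_ν}_{ν>0}` with `limsup_{ν↓0} ν ∫₀¹ ‖∇v_ν‖² > 0` (extract a sequence
`ν_m ↓ 0` realising the `limsup`), forces bounded in `L^{1+σ}([0,1]; C^σ(T³))` for some `σ > 0`
(stronger than the `L¹_t C⁰_x` bound recorded here) and, for each `ν`, a unique solution, bounded
in `L^∞([0,1] × T³)` (smooth, the data and forces being smooth and the construction
`2½`-dimensional). [cite: BCCDS2024, Thm. 1.1] -/
def bccds_onsager_critical : Prop :=
  ∀ (α : ℝ≥0) (hα : α < 1 / 3),
    ∃ (ν : ℕ → ℝ) (u₀ : T3 → R3) (f u : ℕ → ℝ → T3 → R3) (p : ℕ → ℝ → T3 → ℝ),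
      IsVanishingViscosity ν ∧ FunctionSpaces.Torus.IsSmooth u₀ ∧
      (∀ m, FunctionSpaces.Torus.IsSmoothSpaceTimeOn (Icc 0 1) (f m)) ∧
      (∀ m, FunctionSpaces.Torus.IsClassicalNSSolutionOn (Icc 0 1) (ν m) (f m) (u m) (p m) ∧ u m 0 = u₀) ∧
      (∃ C : ℝ≥0∞, C < ∞ ∧ ∀ m, FunctionSpaces.eLpHolderNorm 1 0 (f m) (Icc 0 1) ≤ C) ∧
      HasAnomalousDissipation ν u ∧
      ∃ C : ℝ≥0∞, C < ∞ ∧ ∀ m, FunctionSpaces.eLpHolderNorm 3 α (u m) (Icc 0 1) ≤ C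

end Turb

end Literature.Analysis.FluidPDE

end
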